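import Summits.Ventures.HodgeRepro2.T5SU11SphericalStrict

/-!
# The spherical transform in Cartan coordinates:
`c · ∫_G f φ_λ dμ = 2π ∫_0^∞ f(a_t) φ_λ(a_t) sinh t cosh t dt`, and `f̂(λ) = f̂(2 − λ)`

For a bi-`K`-invariant `f` the product `f · φ_λ` is bi-`K`-invariant, and it is integrable when
`f ∈ L¹(G, μ)` and `0 ≤ λ ≤ 2` (`0 < φ_λ ≤ 1`; `integrable_mul_sph`) or when `f ∈ C_c(G)` and `λ` is
arbitrary (`integrable_mul_sph_of_hasCompactSupport`). The spherical integration formula of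
`T5SU11SphericalIntegral` (`c ∫_G F dμ = 2π ∫_0^∞ sinh t cosh t F(a_t) dt`, `c = haarScalarFactor
(nu haarCircle) μ`) then writes the **spherical transform `f̂(λ) = ∫_G f φ_λ dμ` as a one-dimensional
integral** (`integral_mul_sph_eq_cartan`, `integral_mul_sph_eq_cartan'`, and with `c = 1` for
`ν = nu haarCircle`: `integral_nu_mul_sph_eq_cartan`), and the functional equation `φ_λ = φ_{2-λ}`
gives **`f̂(λ) = f̂(2 − λ)`** (`integral_mul_sph_two_sub`). Nothing is claimed about (N).

Blind lane: Mathlib + the HodgeRepro2 prefix only; no sorry; axioms ⊆ {propext, Classical.choice,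
Quot.sound}.
-/

namespace Summit.Ventures.HodgeRepro2.T5SU11SphericalTransformCartan

open MeasureTheory MeasureTheory.Measure Metric Set Filter Topology Complex
open T5SU11Unimodular T5SU11Fibration T5SU11Cartan T5SU11OneParameter T5SU11CartanProjection
  T5HaarCircle T5BergmanCoefficient T5SU11SphericalFunction T5SU11SphericalTwo
  T5SU11SphericalSymmetry T5SU11SphericalBounds T5SU11SphericalContinuous
  T5SU11SphericalAsymptotic T5SU11SphericalLp T5SU11SphericalCfun T5SU11SphericalLpSharp
  T5SU11SphericalXiLog T5SU11SphericalCfunLimit T5SU11SphericalStrict T5SU11SphericalIntegral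
  T5SU11FibrationHaar
open scoped Real

section measure

variable [MeasurableSpace Circle] [BorelSpace Circle]

/-- `f · sph λ` is integrable for `f ∈ L¹(G, μ)` and `0 ≤ λ ≤ 2`. -/
theorem integrable_mul_sph (μ : Measure SU11) {lam : ℝ} (h0 : 0 ≤ lam) (h2 : lam ≤ 2)
    {f : SU11 → ℝ} (hf : Integrable f μ) : Integrable (fun g => f g * sph lam g) μ := by
  refine hf.mul_bdd (c := 1) (continuous_sph lam).aestronglyMeasurable
    (Filter.Eventually.of_forall fun g => ?_)
  rw [Real.norm_eq_abs, abs_of_pos (sph_pos lam g)]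
  exact sph_le_one h0 h2 g

/-- `f · sph λ` is integrable for `f ∈ C_c(G)` and every `λ` (every Haar measure). -/
theorem integrable_mul_sph_of_hasCompactSupport (μ : Measure SU11) [IsHaarMeasure μ] (lam : ℝ)
    {f : SU11 → ℝ} (hf : Continuous f) (hfc : HasCompactSupport f) :
    Integrable (fun g => f g * sph lam g) μ :=
  (hf.mul (continuous_sph lam)).integrable_of_hasCompactSupport (hfc.mul_right)

/-- `f · sph λ` is bi-`K`-invariant when `f` is. -/
theorem biRotInvariant_mul_sph (lam : ℝ) {f : SU11 → ℝ}
    (hK : ∀ (u v : Circle) (g : SU11), f (rot u * g * rot v) = f g) (u v : Circle) (g : SU11) :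
    f (rot u * g * rot v) * sph lam (rot u * g * rot v) = f g * sph lam g := by
  rw [hK, sph_rot_mul_rot]

/-- **The spherical transform in Cartan coordinates** (`f ∈ L¹`, `0 ≤ λ ≤ 2`):
`c • ∫_G f φ_λ dμ = 2π • ∫_0^∞ (sinh t cosh t) • (f(a_t) φ_λ(a_t)) dt`, `c = haarScalarFactor (nu haarCircle) μ`. -/
theorem integral_mul_sph_eq_cartan (μ : Measure SU11) [IsHaarMeasure μ] {lam : ℝ} (h0 : 0 ≤ lam)
    (h2 : lam ≤ 2) {f : SU11 → ℝ} (hf : Integrable f μ)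
    (hK : ∀ (u v : Circle) (g : SU11), f (rot u * g * rot v) = f g) :
    (haarScalarFactor (nu haarCircle) μ : ℝ) • ∫ g, f g * sph lam g ∂μ =
      (2 * π) • ∫ t in Ioi (0 : ℝ), (Real.sinh t * Real.cosh t) • (f (hyp t) * sph lam (hyp t)) :=
  integral_biRotInvariant μ (integrable_mul_sph μ h0 h2 hf) (biRotInvariant_mul_sph lam hK)

/-- **The spherical transform in Cartan coordinates** (`f ∈ C_c(G)`, every `λ`). -/
theorem integral_mul_sph_eq_cartan' (μ : Measure SU11) [IsHaarMeasure μ] (lam : ℝ) {f : SU11 → ℝ}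
    (hf : Continuous f) (hfc : HasCompactSupport f)
    (hK : ∀ (u v : Circle) (g : SU11), f (rot u * g * rot v) = f g) :
    (haarScalarFactor (nu haarCircle) μ : ℝ) • ∫ g, f g * sph lam g ∂μ =
      (2 * π) • ∫ t in Ioi (0 : ℝ), (Real.sinh t * Real.cosh t) • (f (hyp t) * sph lam (hyp t)) :=
  integral_biRotInvariant μ (integrable_mul_sph_of_hasCompactSupport μ lam hf hfc)
    (biRotInvariant_mul_sph lam hK)

/-- **For `ν = nu haarCircle`** (`c = 1`): `∫_G f φ_λ dν = 2π • ∫_0^∞ (sinh t cosh t) • (f(a_t) φ_λ(a_t)) dt`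
(`f ∈ L¹(ν)`, `0 ≤ λ ≤ 2`). -/
theorem integral_nu_mul_sph_eq_cartan {lam : ℝ} (h0 : 0 ≤ lam) (h2 : lam ≤ 2) {f : SU11 → ℝ}
    (hf : Integrable f (nu haarCircle))
    (hK : ∀ (u v : Circle) (g : SU11), f (rot u * g * rot v) = f g) :
    ∫ g, f g * sph lam g ∂(nu haarCircle) =
      (2 * π) • ∫ t in Ioi (0 : ℝ), (Real.sinh t * Real.cosh t) • (f (hyp t) * sph lam (hyp t)) :=
  integral_nu_biRotInvariant (integrable_mul_sph _ h0 h2 hf) (biRotInvariant_mul_sph lam hK)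

/-- **The functional equation of the spherical transform**: `f̂(λ) = f̂(2 − λ)`. -/
theorem integral_mul_sph_two_sub (μ : Measure SU11) (lam : ℝ) (f : SU11 → ℝ) :
    ∫ g, f g * sph lam g ∂μ = ∫ g, f g * sph (2 - lam) g ∂μ := by
  congr 1
  funext g
  rw [sph_two_sub lam g]

end measure

end Summit.Ventures.HodgeRepro2.T5SU11SphericalTransformCartan
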